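import Mathlib
import HarnessLib

/-!
# Route `KLProgramme` — VL child `KLRegimeVolumeLimitV17F2` (stmt-HubbardSuperconductivity-20440), closer MODEL file M2 «MISMATCH-SLICE», part 2a:
# real algebra of the increment left-hand sides of `sliceIncrPairWt_charSum_l1_le` — homogeneity in the step norm, monotonicity, rate bookkeeping

Cell `gate-hubbard-kl`, seat hubbard-kl-k3c4-p2 (g11; UV / Matsubara all-U lane), ask «MISMATCH-SLICE» (= M2) of the VL registrant k3c4-p1 g11
(KL STATUS 2026-08-27 21:51Z; pen (R75)).  The six rate inequalities of k3c3-p2's increment pair lemma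
`…SectorSliceIncrPairMoment.sliceIncrPairWt_charSum_l1_le` have space left-hand sides that are HOMOGENEOUS in the step norm `t`:
`c₀²·(t³X₃ + 3a₁(t²X₂) + 3a₂(tX₁) + a₃X₀)` (orders three) and `c₀²·(t²X₂ + 2a₁(tX₁) + a₂X₀)` (order two), with `X₀ … X₃` explicit polynomials in
the band increment data `P₀ … P₃`, the band data `K₁ … K₃` and the cutoff constants — every monomial carrying one of `P₀ … P₃`.  This is what lets
part 2b (`…SectorSliceDefectPairFat`) discharge the inequalities BY CONSTRUCTION for arbitrary positive rates (the amplitude is free).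

* `incrLhs3_eq`, `incrLhs2_eq` (identities, `ring`); `incrPoly3_mono`, `incrPoly2_mono` (monotone in `0 ≤ t ≤ t′`); `le_mul_of_div_le'`.

Pure real algebra; no definitions, no named facts. [folklore]
-/

noncomputable section

namespace Summit.HubbardSuperconductivity.HubbardSuperconductivity.Theorems.TorusFourierL2

set_option linter.dupNamespace false -- summit = problem name (single-conjunct summit), D-0017

/-! ## §1 Algebra of the increment left-hand sides: homogeneity in the step norm, monotonicity, rate bookkeeping -/

section Algebra

/-- **The order-three increment left-hand side is homogeneous in the step norm**: the space left-hand side of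
`sliceIncrPairWt_charSum_l1_le` (axes / normal / tangent-isotropic) equals `c₀²·(t³X₃ + 3a₁(t²X₂) + 3a₂(tX₁) + a₃X₀)` with
`X₀ … X₃` free of `t` and of the multiplier data. [folklore] -/
theorem incrLhs3_eq (L : ℕ) (β Λ B₁ B₂ B₃ B₄ P₀ P₁ P₂ P₃ Kb₁ Kb₂ Kb₃ a₁ a₂ a₃ t : ℝ) :
    (1 / (β * (L : ℝ) ^ 2)) ^ 2 *
        (1 * ((128 * B₄ + 1408 * B₃ + 7776 * B₂ + 27648 * B₁ + 24576) * (β * (L : ℝ) ^ 2) / Λ ^ 5 * P₀ * (Kb₁ * t + P₁ * t) ^ 3 +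
        (64 * B₃ + 480 * B₂ + 1728 * B₁ + 1536) * (β * (L : ℝ) ^ 2) / Λ ^ 4 *
          (P₁ * t * (3 * (Kb₁ * t) ^ 2 + 3 * (Kb₁ * t) * (P₁ * t) + (P₁ * t) ^ 2)) +
        3 * ((64 * B₃ + 480 * B₂ + 1728 * B₁ + 1536) * (β * (L : ℝ) ^ 2) / Λ ^ 4 * P₀ *
            ((Kb₁ * t + P₁ * t) * (Kb₂ * t ^ 2 + P₂ * t ^ 2)) +
          (32 * B₂ + 144 * B₁ + 128) * (β * (L : ℝ) ^ 2) / Λ ^ 3 *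
            (Kb₁ * t * (P₂ * t ^ 2) + P₁ * t * (Kb₂ * t ^ 2) + P₁ * t * (P₂ * t ^ 2))) +
        ((32 * B₂ + 144 * B₁ + 128) * (β * (L : ℝ) ^ 2) / Λ ^ 3 * P₀ * (Kb₃ * t ^ 3 + P₃ * t ^ 3) +
          (16 * B₁ + 16) * (β * (L : ℝ) ^ 2) / Λ ^ 2 * (P₃ * t ^ 3))) +
          3 * (a₁ * ((64 * B₃ + 480 * B₂ + 1728 * B₁ + 1536) * (β * (L : ℝ) ^ 2) / Λ ^ 4 * P₀ * (Kb₁ * t + P₁ * t) ^ 2 +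
        (32 * B₂ + 144 * B₁ + 128) * (β * (L : ℝ) ^ 2) / Λ ^ 3 * (P₁ * t * (2 * (Kb₁ * t) + P₁ * t)) +
        ((32 * B₂ + 144 * B₁ + 128) * (β * (L : ℝ) ^ 2) / Λ ^ 3 * P₀ * (Kb₂ * t ^ 2 + P₂ * t ^ 2) +
          (16 * B₁ + 16) * (β * (L : ℝ) ^ 2) / Λ ^ 2 * (P₂ * t ^ 2)))) +
          3 * (a₂ * ((32 * B₂ + 144 * B₁ + 128) * (β * (L : ℝ) ^ 2) / Λ ^ 3 * P₀ * (Kb₁ * t + P₁ * t) +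
            (16 * B₁ + 16) * (β * (L : ℝ) ^ 2) / Λ ^ 2 * (P₁ * t))) +
          a₃ * ((16 * B₁ + 16) * (β * (L : ℝ) ^ 2) / Λ ^ 2 * P₀)) =
      (1 / (β * (L : ℝ) ^ 2)) ^ 2 *
        (t ^ 3 * ((128 * B₄ + 1408 * B₃ + 7776 * B₂ + 27648 * B₁ + 24576) * (β * (L : ℝ) ^ 2) / Λ ^ 5 * P₀ * (Kb₁ + P₁) ^ 3 +
            (64 * B₃ + 480 * B₂ + 1728 * B₁ + 1536) * (β * (L : ℝ) ^ 2) / Λ ^ 4 * (P₁ * (3 * Kb₁ ^ 2 + 3 * Kb₁ * P₁ + P₁ ^ 2)) +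
            3 * ((64 * B₃ + 480 * B₂ + 1728 * B₁ + 1536) * (β * (L : ℝ) ^ 2) / Λ ^ 4 * P₀ * ((Kb₁ + P₁) * (Kb₂ + P₂)) +
              (32 * B₂ + 144 * B₁ + 128) * (β * (L : ℝ) ^ 2) / Λ ^ 3 * (Kb₁ * P₂ + P₁ * Kb₂ + P₁ * P₂)) +
            ((32 * B₂ + 144 * B₁ + 128) * (β * (L : ℝ) ^ 2) / Λ ^ 3 * P₀ * (Kb₃ + P₃) +
              (16 * B₁ + 16) * (β * (L : ℝ) ^ 2) / Λ ^ 2 * P₃)) +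
          3 * (a₁ * (t ^ 2 * ((64 * B₃ + 480 * B₂ + 1728 * B₁ + 1536) * (β * (L : ℝ) ^ 2) / Λ ^ 4 * P₀ * (Kb₁ + P₁) ^ 2 +
            (32 * B₂ + 144 * B₁ + 128) * (β * (L : ℝ) ^ 2) / Λ ^ 3 * (P₁ * (2 * Kb₁ + P₁)) +
            ((32 * B₂ + 144 * B₁ + 128) * (β * (L : ℝ) ^ 2) / Λ ^ 3 * P₀ * (Kb₂ + P₂) +
              (16 * B₁ + 16) * (β * (L : ℝ) ^ 2) / Λ ^ 2 * P₂)))) +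
          3 * (a₂ * (t * ((32 * B₂ + 144 * B₁ + 128) * (β * (L : ℝ) ^ 2) / Λ ^ 3 * P₀ * (Kb₁ + P₁) +
            (16 * B₁ + 16) * (β * (L : ℝ) ^ 2) / Λ ^ 2 * P₁))) +
          a₃ * ((16 * B₁ + 16) * (β * (L : ℝ) ^ 2) / Λ ^ 2 * P₀)) := by
  ring

/-- **The order-two increment left-hand side is homogeneous in the step norm**: the second-order tangent left-hand side of
`sliceIncrPairWt_charSum_l1_le` equals `c₀²·(t²X₂ + 2a₁(tX₁) + a₂X₀)`. [folklore] -/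
theorem incrLhs2_eq (L : ℕ) (β Λ B₁ B₂ B₃ P₀ P₁ P₂ Kb₁ Kb₂ a₁ a₂ t : ℝ) :
    (1 / (β * (L : ℝ) ^ 2)) ^ 2 *
        (1 * ((64 * B₃ + 480 * B₂ + 1728 * B₁ + 1536) * (β * (L : ℝ) ^ 2) / Λ ^ 4 * P₀ * (Kb₁ * t + P₁ * t) ^ 2 +
        (32 * B₂ + 144 * B₁ + 128) * (β * (L : ℝ) ^ 2) / Λ ^ 3 * (P₁ * t * (2 * (Kb₁ * t) + P₁ * t)) +
        ((32 * B₂ + 144 * B₁ + 128) * (β * (L : ℝ) ^ 2) / Λ ^ 3 * P₀ * (Kb₂ * t ^ 2 + P₂ * t ^ 2) +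
          (16 * B₁ + 16) * (β * (L : ℝ) ^ 2) / Λ ^ 2 * (P₂ * t ^ 2))) +
          2 * (a₁ * ((32 * B₂ + 144 * B₁ + 128) * (β * (L : ℝ) ^ 2) / Λ ^ 3 * P₀ * (Kb₁ * t + P₁ * t) +
            (16 * B₁ + 16) * (β * (L : ℝ) ^ 2) / Λ ^ 2 * (P₁ * t))) +
          a₂ * ((16 * B₁ + 16) * (β * (L : ℝ) ^ 2) / Λ ^ 2 * P₀)) =
      (1 / (β * (L : ℝ) ^ 2)) ^ 2 *
        (t ^ 2 * ((64 * B₃ + 480 * B₂ + 1728 * B₁ + 1536) * (β * (L : ℝ) ^ 2) / Λ ^ 4 * P₀ * (Kb₁ + P₁) ^ 2 +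
            (32 * B₂ + 144 * B₁ + 128) * (β * (L : ℝ) ^ 2) / Λ ^ 3 * (P₁ * (2 * Kb₁ + P₁)) +
            ((32 * B₂ + 144 * B₁ + 128) * (β * (L : ℝ) ^ 2) / Λ ^ 3 * P₀ * (Kb₂ + P₂) +
              (16 * B₁ + 16) * (β * (L : ℝ) ^ 2) / Λ ^ 2 * P₂)) +
          2 * (a₁ * (t * ((32 * B₂ + 144 * B₁ + 128) * (β * (L : ℝ) ^ 2) / Λ ^ 3 * P₀ * (Kb₁ + P₁) +
            (16 * B₁ + 16) * (β * (L : ℝ) ^ 2) / Λ ^ 2 * P₁))) +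
          a₂ * ((16 * B₁ + 16) * (β * (L : ℝ) ^ 2) / Λ ^ 2 * P₀)) := by
  ring

/-- **Monotonicity of the homogeneous order-three form in the step norm** (`0 ≤ t ≤ t′`, all data nonnegative). [folklore] -/
theorem incrPoly3_mono {c X₀ X₁ X₂ X₃ a₁ a₂ a₃ t t' : ℝ} (hc : 0 ≤ c) (hX₁ : 0 ≤ X₁) (hX₂ : 0 ≤ X₂) (hX₃ : 0 ≤ X₃)
    (ha₁ : 0 ≤ a₁) (ha₂ : 0 ≤ a₂) (ht0 : 0 ≤ t) (ht : t ≤ t') :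
    c * (t ^ 3 * X₃ + 3 * (a₁ * (t ^ 2 * X₂)) + 3 * (a₂ * (t * X₁)) + a₃ * X₀) ≤
      c * (t' ^ 3 * X₃ + 3 * (a₁ * (t' ^ 2 * X₂)) + 3 * (a₂ * (t' * X₁)) + a₃ * X₀) := by
  have h2 : t ^ 2 ≤ t' ^ 2 := pow_le_pow_left₀ ht0 ht 2
  have h3 : t ^ 3 ≤ t' ^ 3 := pow_le_pow_left₀ ht0 ht 3
  have e1 : t ^ 3 * X₃ ≤ t' ^ 3 * X₃ := mul_le_mul_of_nonneg_right h3 hX₃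
  have e2 : a₁ * (t ^ 2 * X₂) ≤ a₁ * (t' ^ 2 * X₂) := mul_le_mul_of_nonneg_left (mul_le_mul_of_nonneg_right h2 hX₂) ha₁
  have e3 : a₂ * (t * X₁) ≤ a₂ * (t' * X₁) := mul_le_mul_of_nonneg_left (mul_le_mul_of_nonneg_right ht hX₁) ha₂
  exact mul_le_mul_of_nonneg_left (by linarith) hc

/-- **Monotonicity of the homogeneous order-two form in the step norm**. [folklore] -/
theorem incrPoly2_mono {c X₀ X₁ X₂ a₁ a₂ t t' : ℝ} (hc : 0 ≤ c) (hX₁ : 0 ≤ X₁) (hX₂ : 0 ≤ X₂) (ha₁ : 0 ≤ a₁) (ht0 : 0 ≤ t) (ht : t ≤ t') :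
    c * (t ^ 2 * X₂ + 2 * (a₁ * (t * X₁)) + a₂ * X₀) ≤ c * (t' ^ 2 * X₂ + 2 * (a₁ * (t' * X₁)) + a₂ * X₀) := by
  have h2 : t ^ 2 ≤ t' ^ 2 := pow_le_pow_left₀ ht0 ht 2
  have e1 : t ^ 2 * X₂ ≤ t' ^ 2 * X₂ := mul_le_mul_of_nonneg_right h2 hX₂
  have e3 : a₁ * (t * X₁) ≤ a₁ * (t' * X₁) := mul_le_mul_of_nonneg_left (mul_le_mul_of_nonneg_right ht hX₁) ha₁
  exact mul_le_mul_of_nonneg_left (by linarith) hc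

/-- **Rate bookkeeping**: if `T / r ≤ A` with `0 < r` then `T ≤ A · r`. [folklore] -/
theorem le_mul_of_div_le' {T A r : ℝ} (hr : 0 < r) (h : T / r ≤ A) : T ≤ A * r := by
  rwa [div_le_iff₀ hr] at h

end Algebra

end Summit.HubbardSuperconductivity.HubbardSuperconductivity.Theorems.TorusFourierL2

end
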